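import Mathlib
import HarnessLib

/-!
# Door S22 «SelfStrainDoor» (nsreg-p1 ROUND-21; THEOREMS-ONLY landing, DIRECTOR-NS g9 #54 (1)/#57/#60) — the typed substrate

Door S22 of nsreg-p1's local Type-I window-door family (memo `HOME/ns-regularity-ideate-p1/ROUND-21.md` 0ca10a4359a7bf66,
texts `P1/r21/S22EndToEnd.lean` 9b9b0bcc57046adf = `Sketch22v2.lean` ++ `K1OfCommon22.lean`; NO route is born, standing
#32 (2)).  THESIS: «a locally Type-I singularity must keep STRAINING ITSELF ALONG ITS OWN STREAMLINES on every similarity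
window, to the end.»  Fine structure = the SELF-STRAIN density `σ(u)(x) = ⟪u(x), (u·∇)u(x)⟫ = |u|²·S(û,û) = (u·∇)½|u|²`
(first order, LOCAL — no `Λ`, no pressure; scale dimension `−4`).  DOOR (`…Theorems.SelfStrainDoor.selfStrainDoor`): a
classical Leray–Hopf flow, locally space–time Type I at `(x₀,T)`, whose scale-normalised self-strain
`(T−t)²|σ(u(t))(x₀+√(T−t)·)|` fades in `L¹` on ONE similarity window is backward bounded at `(x₀,T)` — because (K2,
`…Theorems.SelfStrainDoorProfileRigidity.selfStrainFreeProfileRigidity`, PROVED) Type-I ancient mild profiles that are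
self-strain-free on an open set of every slice are not backward-singular: on a self-strain-free slice `⟨v⟩v` is
divergence-free, so the WINDOWED REGULARISED CUBIC BUDGET `d/dt ∫ a φ₁(v)` has only cutoff terms, `sup_t ∫_{B₁}|v|³ < ∞`, and
ESS in the class concludes.

This file fixes the vocabulary ONCE (texts of `S22EndToEnd.lean` verbatim) so that the four theorem files
`SelfStrainDoorCubicCalculus` → `SelfStrainDoorCubicBudget` → `SelfStrainDoorProfileRigidity` → `SelfStrainDoor` cite tree
declarations:

* `selfStrain u x = ⟪u x, Du(x)(u x)⟫` and `IsSelfStrainFree u` (`σ(u) ≡ 0`) — the door's two notions;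
* the proof devices of the cubic budget: the regularised speed `jb w = ⟨w⟩ = √(‖w‖²+1)`, the regularised cubic density
  `cubeReg w = φ₁(w) = ⟨w⟩³/3` (`∇φ₁(w) = ⟨w⟩ w`, `φ₁(w) ≥ ‖w‖³/3`), and the test field `psi a u = (a·⟨u⟩) u`;
* only the small algebra needed to USE them (positivity, `⟨w⟩² = ‖w‖²+1`, `‖w‖ ≤ ⟨w⟩`, `1 ≤ ⟨w⟩`, `‖w‖³ ≤ 3φ₁(w)`,
  continuity).

`lean search` 2026-08-27: no `selfStrain`/self-strain density, no regularised cubic density `(‖w‖²+1)^{3/2}` on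
`EuclideanSpace ℝ (Fin 3)` in `Literature`/`Summits` (nearest: the direction-dissipation and enstrophy-production densities of
`LocalTubeStrainDoor*`, `PlaneStrainDoor*` — gradient-only scalars; Vasseur 2009's `div(u/|u|)` criterion is not in the tree).

Seat `ns-pressure-K2-p1` g5 (prover lane designated by DIRECTOR-NS #60 (1)); texts and design by nsreg-p1 g18/g19.
WHAT THIS IS NOT: not NS regularity (Clay A); a CONDITIONAL door's vocabulary (bears_on LADDER-NS N0 door family S22;
evades the hard cores by hypothesis); no route is opened.
-/

noncomputable section

-- the summit and its single sub-problem share the name (CONVENTIONS §1), as in every Theorems file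
set_option linter.dupNamespace false

namespace Summit.NavierStokesRegularity.NavierStokesRegularity.Theorems.SelfStrainDoorDefs

open scoped RealInnerProductSpace

/-! ### The door's two notions -/

/-- The SELF-STRAIN density `σ(u)(x) = ⟪u(x), Du(x)[u(x)]⟫ = |u(x)|²·S(x)(û,û) = (u·∇)(½|u|²)(x)`: the rate at which the flow
stretches the fluid along its own streamlines (equivalently, the advective growth of kinetic energy).  Scale dimension `−4`;
vanishes iff the speed is constant along streamlines. -/
def selfStrain (u : EuclideanSpace ℝ (Fin 3) → EuclideanSpace ℝ (Fin 3)) (x : EuclideanSpace ℝ (Fin 3)) : ℝ :=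
  inner ℝ (u x) (fderiv ℝ u x (u x))

/-- SELF-STRAIN-FREE slice: `σ(u) ≡ 0` (parallel shear flows, circular vortices `u = V(r)e_θ`; in general exactly the fields
whose speed is constant along their own streamlines). -/
def IsSelfStrainFree (u : EuclideanSpace ℝ (Fin 3) → EuclideanSpace ℝ (Fin 3)) : Prop := ∀ x, selfStrain u x = 0

/-- Unfolding `selfStrain`. -/
theorem selfStrain_apply (u : EuclideanSpace ℝ (Fin 3) → EuclideanSpace ℝ (Fin 3)) (x : EuclideanSpace ℝ (Fin 3)) :
    selfStrain u x = ⟪u x, fderiv ℝ u x (u x)⟫ := rfl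

/-- Unfolding `IsSelfStrainFree`. -/
theorem isSelfStrainFree_iff (u : EuclideanSpace ℝ (Fin 3) → EuclideanSpace ℝ (Fin 3)) :
    IsSelfStrainFree u ↔ ∀ x, selfStrain u x = 0 := Iff.rfl

/-! ### The proof devices of the windowed cubic budget -/

/-- The regularised speed `⟨w⟩ = √(‖w‖²+1)`. -/
def jb (w : EuclideanSpace ℝ (Fin 3)) : ℝ := Real.sqrt (‖w‖ ^ 2 + 1)

/-- The REGULARISED CUBIC density `φ₁(w) = (‖w‖²+1)^{3/2}/3 = ⟨w⟩³/3` (smooth, convex, `∇φ₁(w) = ⟨w⟩ w`, `φ₁(w) ≥ ‖w‖³/3`). -/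
def cubeReg (w : EuclideanSpace ℝ (Fin 3)) : ℝ := Real.sqrt (‖w‖ ^ 2 + 1) ^ 3 / 3

/-- The test field `ψ = (a·⟨u⟩) u` of the cubic budget (`a` a cutoff). -/
def psi (a : EuclideanSpace ℝ (Fin 3) → ℝ) (u : EuclideanSpace ℝ (Fin 3) → EuclideanSpace ℝ (Fin 3))
    (x : EuclideanSpace ℝ (Fin 3)) : EuclideanSpace ℝ (Fin 3) :=
  (a x * jb (u x)) • u x

/-- Unfolding `jb`. -/
theorem jb_def (w : EuclideanSpace ℝ (Fin 3)) : jb w = Real.sqrt (‖w‖ ^ 2 + 1) := rfl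

/-- Unfolding `cubeReg`. -/
theorem cubeReg_def (w : EuclideanSpace ℝ (Fin 3)) : cubeReg w = Real.sqrt (‖w‖ ^ 2 + 1) ^ 3 / 3 := rfl

/-- Unfolding `psi`. -/
theorem psi_apply (a : EuclideanSpace ℝ (Fin 3) → ℝ) (u : EuclideanSpace ℝ (Fin 3) → EuclideanSpace ℝ (Fin 3))
    (x : EuclideanSpace ℝ (Fin 3)) : psi a u x = (a x * jb (u x)) • u x := rfl

/-- `⟨w⟩ > 0`. -/
theorem jb_pos (w : EuclideanSpace ℝ (Fin 3)) : 0 < jb w := Real.sqrt_pos.2 (by positivity)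

/-- `⟨w⟩² = ‖w‖² + 1`. -/
theorem jb_sq (w : EuclideanSpace ℝ (Fin 3)) : jb w ^ 2 = ‖w‖ ^ 2 + 1 := by
  unfold jb; rw [Real.sq_sqrt (by positivity)]

/-- `‖w‖ ≤ ⟨w⟩`. -/
theorem norm_le_jb (w : EuclideanSpace ℝ (Fin 3)) : ‖w‖ ≤ jb w := by
  have h := jb_sq w
  nlinarith [jb_pos w, norm_nonneg w]

/-- `1 ≤ ⟨w⟩`. -/
theorem one_le_jb (w : EuclideanSpace ℝ (Fin 3)) : 1 ≤ jb w := by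
  have h := jb_sq w
  nlinarith [jb_pos w, norm_nonneg w]

/-- `‖w‖ ≤ M ⇒ ⟨w⟩ ≤ M + 1`. -/
theorem jb_le_of_norm_le {w : EuclideanSpace ℝ (Fin 3)} {M : ℝ} (hM : 0 ≤ M) (h : ‖w‖ ≤ M) : jb w ≤ M + 1 := by
  have h2 := jb_sq w
  have h3 : ‖w‖ ^ 2 ≤ M ^ 2 := pow_le_pow_left₀ (norm_nonneg _) h 2
  nlinarith [jb_pos w]

/-- `⟨w⟩` through the inner product. -/
theorem jb_eq_inner (w : EuclideanSpace ℝ (Fin 3)) : jb w = Real.sqrt (⟪w, w⟫ + 1) := by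
  rw [jb, real_inner_self_eq_norm_sq]

/-- `φ₁(w) = ⟨w⟩³/3`. -/
theorem cubeReg_eq (w : EuclideanSpace ℝ (Fin 3)) : cubeReg w = jb w ^ 3 / 3 := rfl

/-- `φ₁(w)` through the inner product. -/
theorem cubeReg_eq_inner (w : EuclideanSpace ℝ (Fin 3)) : cubeReg w = Real.sqrt (⟪w, w⟫ + 1) ^ 3 / 3 := by
  rw [cubeReg, real_inner_self_eq_norm_sq]

/-- `φ₁ ≥ 0`. -/
theorem cubeReg_nonneg (w : EuclideanSpace ℝ (Fin 3)) : 0 ≤ cubeReg w := by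
  unfold cubeReg; positivity

/-- `‖w‖³ ≤ 3 φ₁(w)`. -/
theorem norm_pow_three_le_cubeReg (w : EuclideanSpace ℝ (Fin 3)) : ‖w‖ ^ 3 ≤ 3 * cubeReg w := by
  unfold cubeReg
  have h : ‖w‖ ≤ Real.sqrt (‖w‖ ^ 2 + 1) := by
    have h1 := Real.abs_le_sqrt (show ‖w‖ ^ 2 ≤ ‖w‖ ^ 2 + 1 by linarith)
    rwa [abs_of_nonneg (norm_nonneg _)] at h1
  have h3 : ‖w‖ ^ 3 ≤ Real.sqrt (‖w‖ ^ 2 + 1) ^ 3 := by gcongr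
  linarith

/-- `⟨·⟩` is continuous. -/
theorem continuous_jb : Continuous jb := by
  unfold jb; fun_prop

/-- `φ₁` is continuous. -/
theorem continuous_cubeReg : Continuous cubeReg := by
  unfold cubeReg; fun_prop

end Summit.NavierStokesRegularity.NavierStokesRegularity.Theorems.SelfStrainDoorDefs

end
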